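import Literature.MathematicalPhysics.QuantumLattice.TorusGibbsEnergyEntropyBalance
import Literature.MathematicalPhysics.QuantumLattice.HubbardTTPrimeWindowCertificateAbstractState
import HarnessLib

/-!
# Thermal torus-limit states of the `t–t'` Hubbard model satisfy the linearised energy–entropy
# balance rows and the stationarity rows (the `T > 0` constraint set of a state relaxation)

Topic `Literature/MathematicalPhysics/QuantumLattice`; the positive-temperature companion of
`InfVolFermionStateTorusLimitLocalStability.lean` (torus limits of sector GROUND states satisfy the
Bratteli–Robinson local ground-state inequality `ω(Ã⋆[H_{Λ₁}, Ã]) ≥ 0` for gauge-invariant `A`).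
Here the finite-volume states are the canonical GIBBS states `ρ_{L,β} ∝ P_K e^{−βH_L}` of the `t–t'`
Hubbard torus `H_L = hubbardTorusTT' L t t' U` on the sector `K = (rectN n L, S^z = 0)`, written as
eigen-mixtures (`sectorGibbsWeightTT'`, `sectorGibbsVectorTT'`, `TorusSectorGibbsMixture.lean`), and
`ω` is any torus limit of their translation averages along `Ls → ∞`
(`InfVolFermionState.IsTorusLimitOfMixture`: the tree's *torus-limit thermal convention*). We prove
that `ω` satisfies, for every finite region `Λ`, `Λ₁ = thicken Λ 1`, `H_{Λ₁}` the free-boundary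
local Hamiltonian of `hubbardTTPrimeFermionInteraction t t' U`:

* the **stationarity (equation-of-motion) rows** `ω(H_{Λ'} ΓB − ΓB H_{Λ'}) = 0` for EVERY local
  `B ∈ 𝔄_Λ` and every window `Λ' ⊇ thicken Λ 1`
  (`IsTorusLimitOfMixture.expect_commutator_localHamiltonian_eq_zero_of_sectorGibbs`; each Gibbs
  component is an eigenvector of `H_L`, and `[H_L, ΓB] = Γ[H_{Λ'}, B]` on the torus);
* the **linearised energy–entropy balance (EEB) rows**
  `0 ≤ Re ω(β·Ãᴴ(H_{Λ₁}Ã − ÃH_{Λ₁}) − s·ÃᴴÃ + q·ÃÃᴴ)`, `e^{s−1} ≤ q`,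
  for every local `A ∈ 𝔄_Λ` conserving the local particle number and `S^z` (`Ã = A` embedded in
  `𝔄_{Λ₁}`; `IsTorusLimitOfMixture.re_expect_eeb_nonneg_of_sectorGibbs`, and the same row written in
  any window `Λ' ⊇ thicken Λ 1`, `…_of_thicken_subset`) — the finite-volume inequality is
  `sum_sectorGibbsWeightTT'_mul_re_expect_eeb_fockTranslate_nonneg`
  (`TorusGibbsEnergyEntropyBalance.lean`) for the sector-preserving torus observable `ΓÃ` in the
  translated mixtures `(p_{L,i}, U_v ψ_{L,i})`, averaged over `v` (§1) and passed to the limit (§2).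

These are exactly the two constraint families that distinguish a thermal (KMS) state from an arbitrary
translation-invariant state in the certified relaxations of Fawzi–Fawzi–Scalet (Thm. 3.1, (opt2));
for CANONICAL limits the EEB rows are restricted, as they must be, to gauge-invariant generators `A`
(the canonical state is not KMS for number-changing perturbations). No hypothesis on `β`, `U`, `n` is
needed for either family (the weights need not be normalised for an inequality `≥ 0`). Everything is
PROVED; no definition, no named fact.

## Mathlib / tree search

REUSED: `sum_sectorGibbsWeightTT'_mul_re_expect_eeb_fockTranslate_nonneg`,
`star_fockTranslate_mulVec_dotProduct_commutator_mulVec_eq_zero` (`TorusGibbsEnergyEntropyBalance`);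
`hubbardTorusTT'_commutator_fermionEmbed` (`HubbardNNNHoppingLocalHamiltonian`),
`commute_fermionEmbed_toTorusEmb_totalNumber/spinZ` (`InfVolFermionStateTorusLimitLocalStability`),
`torusAvgExpectAt_of_injOn`, `torusAvgExpect_eq`, `eventually_injOn_proj_of_tendsto`,
`fermionEmbed_fermionEmbed/congr/add/sub/smul/mul/conjTranspose`, `InfVolFermionState.compatible`
(`InfVolFermionState`), `hubbardTTPrime_localHamiltonian_commutator_fermionEmbed_eq`
(`HubbardTTPrimeWindowCertificateAbstractState`). `lean search 'IsTorusLimitOfMixture.*commutator|KMS.*torus'`: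
no thermal constraint rows for torus-limit states in the tree (2026-08-26).

## References

* H. Fawzi, O. Fawzi, S. O. Scalet, Nat. Commun. 15 (2024) 7394 = arXiv:2311.18706, §3.1 Thm. 3.1
  (a state is β-KMS iff it is stationary and satisfies the EEB inequalities), §3.2 (opt1)/(opt2).
  [cite: FawziFawziScalet2024, Thm. 3.1]
* H. Araki, H. Moriya, Rev. Math. Phys. 15 (2003) 93, Def. 6.3 / Thm. 6.4 (dKMS ⟺ KMS for lattice
  fermions). [cite: ArakiMoriya2003, Def. 6.3]
* O. Bratteli, D. W. Robinson, *Operator Algebras and Quantum Statistical Mechanics 2* (1997),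
  Thm. 5.3.15 and Thm. 6.2.4. [cite: BratteliRobinsonII1997, Thm. 5.3.15]
* R. B. Israel, *Convexity in the Theory of Lattice Gases* (1979), §I.3 eq. (26) and §III.1 (Gibbs
  states with periodic boundary conditions and their invariant limits). [cite: Israel1979, §I.3 eq. (26)]
-/

noncomputable section

namespace Literature.MathematicalPhysics.QuantumLattice

open Matrix Finset HubbardWave0 Literature.Probability.LatticeModels ThermodynamicLimit
open _root_.Filter
open scoped _root_.Topology ComplexOrder BigOperators

/-! ### §1 Translation averages of the embedded local rows on the torus -/

section TorusAverage

variable (L : ℕ) [NeZero L] (t t' U : ℝ)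

/-- **The EEB row of a local generator, averaged over the torus translations, is nonnegative in the
canonical Gibbs mixture.** For a region `Λ` with `x ↦ x mod L` injective on `thicken (thicken Λ 1) 1`,
a local `A ∈ 𝔄_Λ` conserving the local `N` and `S^z`, `Λ₁ = thicken Λ 1`, `Ã = A` embedded in
`𝔄_{Λ₁}`, `H_{Λ₁}` the free-boundary `t–t'–U` Hamiltonian of `Λ₁`, and `e^{s−1} ≤ q`:
`0 ≤ Re Σ_i p_{L,i} · torusAvgExpectAt L Λ₁ (β·Ãᴴ(H_{Λ₁}Ã − ÃH_{Λ₁}) − s·ÃᴴÃ + q·ÃÃᴴ) ψ_{L,i}`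
(pull-back into the torus: `[H_L, ΓÃ] = Γ[H_{Λ₁}, Ã]`, `hubbardTorusTT'_commutator_fermionEmbed`;
`ΓÃ` conserves the torus `N`, `S^z`; then the translated-mixture inequality for every `v`).
[cite: FawziFawziScalet2024, Thm. 3.1] -/
theorem re_sum_sectorGibbsWeightTT'_mul_torusAvgExpectAt_eeb_nonneg (n β : ℝ) {Λ : Finset (Site 2)}
    (hInj : Set.InjOn (Torus.proj (d := 2) L) ↑(thicken (thicken Λ 1) 1))
    {A : FermionOp Λ} (hAN : Commute A totalNumber) (hAS : Commute A HubbardWave0.spinZ)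
    {s q : ℝ} (hq : Real.exp (s - 1) ≤ q) :
    0 ≤ (∑ i, (sectorGibbsWeightTT' β t t' U n L i : ℂ) *
      torusAvgExpectAt L (thicken Λ 1)
        (((β : ℝ) : ℂ) • ((fermionEmbed (PolySite.incl (subset_thicken Λ 1)) A)ᴴ *
            ((hubbardTTPrimeFermionInteraction t t' U).localHamiltonian (thicken Λ 1) *
                fermionEmbed (PolySite.incl (subset_thicken Λ 1)) A -
              fermionEmbed (PolySite.incl (subset_thicken Λ 1)) A *
                (hubbardTTPrimeFermionInteraction t t' U).localHamiltonian (thicken Λ 1))) -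
          ((s : ℝ) : ℂ) • ((fermionEmbed (PolySite.incl (subset_thicken Λ 1)) A)ᴴ *
            fermionEmbed (PolySite.incl (subset_thicken Λ 1)) A) +
          ((q : ℝ) : ℂ) • (fermionEmbed (PolySite.incl (subset_thicken Λ 1)) A *
            (fermionEmbed (PolySite.incl (subset_thicken Λ 1)) A)ᴴ))
        (sectorGibbsVectorTT' t t' U n L i)).re := by
  have h₁ : Set.InjOn (Torus.proj (d := 2) L) ↑(thicken Λ 1) :=
    hInj.mono (by exact_mod_cast subset_thicken (thicken Λ 1) 1)
  have hΛ : Set.InjOn (Torus.proj (d := 2) L) ↑Λ :=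
    hInj.mono (by exact_mod_cast (subset_thicken Λ 1).trans (subset_thicken (thicken Λ 1) 1))
  -- the embedded generator, as an embedding of `Λ` itself, and its conservation laws on the torus
  set B := fermionEmbed (PolySite.toTorusEmb L hΛ) A with hBdef
  have hB : fermionEmbed (PolySite.toTorusEmb L h₁) (fermionEmbed (PolySite.incl (subset_thicken Λ 1)) A) = B := by
    rw [hBdef, fermionEmbed_fermionEmbed]
    exact congrFun (congrArg DFunLike.coe (fermionEmbed_congr fun p => rfl)) A
  have hBN : Commute B totalNumber := commute_fermionEmbed_toTorusEmb_totalNumber L hΛ hAN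
  have hBS : Commute B HubbardWave0.spinZ := commute_fermionEmbed_toTorusEmb_spinZ L hΛ hAS
  -- pull the row back into the torus
  have hΓ : fermionEmbed (PolySite.toTorusEmb L h₁)
      (((β : ℝ) : ℂ) • ((fermionEmbed (PolySite.incl (subset_thicken Λ 1)) A)ᴴ *
            ((hubbardTTPrimeFermionInteraction t t' U).localHamiltonian (thicken Λ 1) *
                fermionEmbed (PolySite.incl (subset_thicken Λ 1)) A -
              fermionEmbed (PolySite.incl (subset_thicken Λ 1)) A *
                (hubbardTTPrimeFermionInteraction t t' U).localHamiltonian (thicken Λ 1))) -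
          ((s : ℝ) : ℂ) • ((fermionEmbed (PolySite.incl (subset_thicken Λ 1)) A)ᴴ *
            fermionEmbed (PolySite.incl (subset_thicken Λ 1)) A) +
          ((q : ℝ) : ℂ) • (fermionEmbed (PolySite.incl (subset_thicken Λ 1)) A *
            (fermionEmbed (PolySite.incl (subset_thicken Λ 1)) A)ᴴ)) =
      ((β : ℝ) : ℂ) • (Bᴴ * (hubbardTorusTT' L t t' U * B - B * hubbardTorusTT' L t t' U)) -
        ((s : ℝ) : ℂ) • (Bᴴ * B) + ((q : ℝ) : ℂ) • (B * Bᴴ) := by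
    rw [fermionEmbed_add, fermionEmbed_sub, fermionEmbed_smul, fermionEmbed_smul, fermionEmbed_smul,
      fermionEmbed_mul, fermionEmbed_mul, fermionEmbed_mul, fermionEmbed_conjTranspose,
      ← hubbardTorusTT'_commutator_fermionEmbed L t t' U (subset_thicken Λ 1) subset_rfl hInj A, hB]
  -- each translate is nonnegative
  have hv : ∀ v : TorusSite 2 L, 0 ≤ ∑ i, sectorGibbsWeightTT' β t t' U n L i *
      (expect (((β : ℝ) : ℂ) • (Bᴴ * (hubbardTorusTT' L t t' U * B - B * hubbardTorusTT' L t t' U)) -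
        ((s : ℝ) : ℂ) • (Bᴴ * B) + ((q : ℝ) : ℂ) • (B * Bᴴ))
        ((fockTranslate v).val *ᵥ sectorGibbsVectorTT' t t' U n L i)).re := fun v =>
    sum_sectorGibbsWeightTT'_mul_re_expect_eeb_fockTranslate_nonneg L t t' U n β v hBN hBS hq
  -- bookkeeping: real part of the weighted translation average
  have hcast : ((Fintype.card (TorusSite 2 L) : ℂ))⁻¹ = (((Fintype.card (TorusSite 2 L) : ℝ)⁻¹ : ℝ) : ℂ) := by
    push_cast; rfl
  simp_rw [torusAvgExpectAt_of_injOn L h₁, hΓ]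
  rw [Complex.re_sum]
  simp_rw [hcast, ← mul_assoc, ← Complex.ofReal_mul, Complex.re_ofReal_mul, Complex.re_sum, Finset.mul_sum]
  rw [Finset.sum_comm]
  refine Finset.sum_nonneg fun v _ => ?_
  have hfac : ∑ i, sectorGibbsWeightTT' β t t' U n L i * (Fintype.card (TorusSite 2 L) : ℝ)⁻¹ *
      (expect (((β : ℝ) : ℂ) • (Bᴴ * (hubbardTorusTT' L t t' U * B - B * hubbardTorusTT' L t t' U)) -
        ((s : ℝ) : ℂ) • (Bᴴ * B) + ((q : ℝ) : ℂ) • (B * Bᴴ))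
        ((fockTranslate v).val *ᵥ sectorGibbsVectorTT' t t' U n L i)).re =
      (Fintype.card (TorusSite 2 L) : ℝ)⁻¹ * ∑ i, sectorGibbsWeightTT' β t t' U n L i *
      (expect (((β : ℝ) : ℂ) • (Bᴴ * (hubbardTorusTT' L t t' U * B - B * hubbardTorusTT' L t t' U)) -
        ((s : ℝ) : ℂ) • (Bᴴ * B) + ((q : ℝ) : ℂ) • (B * Bᴴ))
        ((fockTranslate v).val *ᵥ sectorGibbsVectorTT' t t' U n L i)).re := by
    rw [Finset.mul_sum]
    exact Finset.sum_congr rfl fun i _ => by ring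
  rw [hfac]
  exact mul_nonneg (inv_nonneg.2 (Nat.cast_nonneg _)) (hv v)

/-- **The stationarity row of a local observable vanishes in every translated Gibbs component**:
for `Λ ⊆ Λ'`, `thicken Λ 1 ⊆ Λ'`, `x ↦ x mod L` injective on `thicken Λ' 1` and every `B ∈ 𝔄_Λ`,
`torusAvgExpectAt L Λ' (H_{Λ'} ΓB − ΓB H_{Λ'}) ψ_{L,i} = 0` (`[H_L, Γ'ΓB] = Γ'[H_{Λ'}, ΓB]`).
[cite: FawziFawziScalet2024, Thm. 3.1] -/
theorem torusAvgExpectAt_commutator_localHamiltonian_sectorGibbsVectorTT' (n : ℝ)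
    {Λ Λ' : Finset (Site 2)} (hΛ : Λ ⊆ Λ') (h8 : thicken Λ 1 ⊆ Λ')
    (hInj : Set.InjOn (Torus.proj (d := 2) L) ↑(thicken Λ' 1)) (B : FermionOp Λ)
    (i : Fin (sectorGibbsCount n L)) :
    torusAvgExpectAt L Λ'
        ((hubbardTTPrimeFermionInteraction t t' U).localHamiltonian Λ' * fermionEmbed (PolySite.incl hΛ) B -
          fermionEmbed (PolySite.incl hΛ) B * (hubbardTTPrimeFermionInteraction t t' U).localHamiltonian Λ')
        (sectorGibbsVectorTT' t t' U n L i) = 0 := by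
  have h₁ : Set.InjOn (Torus.proj (d := 2) L) ↑Λ' := hInj.mono (by exact_mod_cast subset_thicken Λ' 1)
  rw [torusAvgExpectAt_of_injOn L h₁, ← hubbardTorusTT'_commutator_fermionEmbed L t t' U hΛ h8 hInj B,
    Finset.sum_eq_zero fun v _ => ?_, mul_zero]
  rw [expect]
  exact star_fockTranslate_mulVec_dotProduct_commutator_mulVec_eq_zero L t t' U n v i _

end TorusAverage

/-! ### §2 The rows of thermal torus-limit states -/

namespace InfVolFermionState

/-- **Stationarity (equation-of-motion) rows of thermal torus limits.** Let `ω` be a torus limit of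
the canonical Gibbs states of `hubbardTorusTT' (Ls j) t t' U` on the sectors
`(rectN n (Ls j), S^z = 0)` along `Ls → ∞` (any `β, t, t', U, n`). Then for `Λ ⊆ Λ'` with
`thicken Λ 1 ⊆ Λ'` and EVERY local `B ∈ 𝔄_Λ`: `ω_{Λ'}(H^{tt'}_{Λ'} ΓB − ΓB H^{tt'}_{Λ'}) = 0` — the
state is stationary for the local dynamics (Fawzi–Fawzi–Scalet Thm. 3.1 (a); Bratteli–Robinson II
Thm. 6.2.4 for `δ(B) = i[H_{Λ'}, B]`). [cite: FawziFawziScalet2024, Thm. 3.1] -/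
theorem IsTorusLimitOfMixture.expect_commutator_localHamiltonian_eq_zero_of_sectorGibbs
    (t t' U : ℝ) {n : ℝ} (β : ℝ) {ω : InfVolFermionState 2} {Ls : ℕ → ℕ}
    (h : ω.IsTorusLimitOfMixture (sectorGibbsCount n) (fun L => sectorGibbsWeightTT' β t t' U n L)
      (fun L => sectorGibbsVectorTT' t t' U n L) Ls)
    (hLs : Tendsto Ls atTop atTop) {Λ Λ' : Finset (Site 2)} (hΛ : Λ ⊆ Λ') (h8 : thicken Λ 1 ⊆ Λ')
    (B : FermionOp Λ) :
    ω.expect Λ'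
      ((hubbardTTPrimeFermionInteraction t t' U).localHamiltonian Λ' * fermionEmbed (PolySite.incl hΛ) B -
        fermionEmbed (PolySite.incl hΛ) B * (hubbardTTPrimeFermionInteraction t t' U).localHamiltonian Λ') = 0 := by
  refine tendsto_nhds_unique (h Λ' _) (tendsto_const_nhds.congr' ?_)
  filter_upwards [eventually_injOn_proj_of_tendsto (thicken Λ' 1) hLs, hLs.eventually_ge_atTop 1]
    with j hInj hj
  haveI : NeZero (Ls j) := ⟨by omega⟩
  refine (Finset.sum_eq_zero fun i _ => ?_).symm
  rw [torusAvgExpect_eq, torusAvgExpectAt_commutator_localHamiltonian_sectorGibbsVectorTT' (Ls j) t t' U n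
    hΛ h8 hInj B i, mul_zero]

/-- **Linearised energy–entropy balance rows of thermal torus limits.** Let `ω` be a torus limit of
the canonical Gibbs states of `hubbardTorusTT' (Ls j) t t' U` at inverse temperature `β` on the
sectors `(rectN n (Ls j), S^z = 0)` along `Ls → ∞`. Then for every region `Λ`, every local
`A ∈ 𝔄_Λ` conserving the local particle number and `S^z`, and all real `s, q` with `e^{s−1} ≤ q`:
`0 ≤ Re ω_{Λ₁}(β·Ãᴴ(H^{tt'}_{Λ₁}Ã − ÃH^{tt'}_{Λ₁}) − s·ÃᴴÃ + q·ÃÃᴴ)`, `Λ₁ = thicken Λ 1`, `Ã = Γ_{Λ⊆Λ₁}A`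
— i.e. `s·ω(Ã⋆Ã) − q·ω(ÃÃ⋆) ≤ β·ω(Ã⋆[H_{Λ₁}, Ã])`, the linearisation at slope `s` of the Araki–Sewell
energy–entropy balance inequality `ω(a⋆a) log(ω(a⋆a)/ω(aa⋆)) ≤ β ω(a⋆[H,a])` of a `β`-KMS state,
here for the gauge-invariant generators of a canonical limit. [cite: FawziFawziScalet2024, Thm. 3.1] -/
theorem IsTorusLimitOfMixture.re_expect_eeb_nonneg_of_sectorGibbs
    (t t' U : ℝ) {n : ℝ} (β : ℝ) {ω : InfVolFermionState 2} {Ls : ℕ → ℕ}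
    (h : ω.IsTorusLimitOfMixture (sectorGibbsCount n) (fun L => sectorGibbsWeightTT' β t t' U n L)
      (fun L => sectorGibbsVectorTT' t t' U n L) Ls)
    (hLs : Tendsto Ls atTop atTop) {Λ : Finset (Site 2)} {A : FermionOp Λ}
    (hAN : Commute A totalNumber) (hAS : Commute A HubbardWave0.spinZ)
    {s q : ℝ} (hq : Real.exp (s - 1) ≤ q) :
    0 ≤ (ω.expect (thicken Λ 1)
      (((β : ℝ) : ℂ) • ((fermionEmbed (PolySite.incl (subset_thicken Λ 1)) A)ᴴ *
          ((hubbardTTPrimeFermionInteraction t t' U).localHamiltonian (thicken Λ 1) *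
              fermionEmbed (PolySite.incl (subset_thicken Λ 1)) A -
            fermionEmbed (PolySite.incl (subset_thicken Λ 1)) A *
              (hubbardTTPrimeFermionInteraction t t' U).localHamiltonian (thicken Λ 1))) -
        ((s : ℝ) : ℂ) • ((fermionEmbed (PolySite.incl (subset_thicken Λ 1)) A)ᴴ *
          fermionEmbed (PolySite.incl (subset_thicken Λ 1)) A) +
        ((q : ℝ) : ℂ) • (fermionEmbed (PolySite.incl (subset_thicken Λ 1)) A *
          (fermionEmbed (PolySite.incl (subset_thicken Λ 1)) A)ᴴ))).re := by
  refine ge_of_tendsto ((Complex.continuous_re.tendsto _).comp (h (thicken Λ 1) _)) ?_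
  filter_upwards [eventually_injOn_proj_of_tendsto (thicken (thicken Λ 1) 1) hLs, hLs.eventually_ge_atTop 1]
    with j hInj hj
  haveI : NeZero (Ls j) := ⟨by omega⟩
  rw [Function.comp_apply]
  simp_rw [torusAvgExpect_eq]
  exact re_sum_sectorGibbsWeightTT'_mul_torusAvgExpectAt_eeb_nonneg (Ls j) t t' U n β hInj hAN hAS hq

/-- **The EEB rows in an arbitrary window.** Under the hypotheses of
`re_expect_eeb_nonneg_of_sectorGibbs`, for every window `Λ' ⊇ thicken Λ 1` (`Λ ⊆ Λ'`) the same row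
written with the local Hamiltonian of `Λ'` and `Γ = Γ_{Λ⊆Λ'}` holds:
`0 ≤ Re ω_{Λ'}(β·(ΓA)ᴴ(H^{tt'}_{Λ'}ΓA − ΓA H^{tt'}_{Λ'}) − s·(ΓA)ᴴΓA + q·ΓA(ΓA)ᴴ)` — the terms of
`H_{Λ'}` outside `thicken Λ 1` commute with `ΓA` (`hubbardTTPrime_localHamiltonian_commutator_fermionEmbed_eq`)
and `ω` is compatible with the inclusions. This is the shape in which a window certificate carries
the rows. [cite: FawziFawziScalet2024, Thm. 3.1] -/
theorem IsTorusLimitOfMixture.re_expect_eeb_nonneg_of_sectorGibbs_of_thicken_subset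
    (t t' U : ℝ) {n : ℝ} (β : ℝ) {ω : InfVolFermionState 2} {Ls : ℕ → ℕ}
    (h : ω.IsTorusLimitOfMixture (sectorGibbsCount n) (fun L => sectorGibbsWeightTT' β t t' U n L)
      (fun L => sectorGibbsVectorTT' t t' U n L) Ls)
    (hLs : Tendsto Ls atTop atTop) {Λ Λ' : Finset (Site 2)} (hΛ : Λ ⊆ Λ') (h8 : thicken Λ 1 ⊆ Λ')
    {A : FermionOp Λ} (hAN : Commute A totalNumber) (hAS : Commute A HubbardWave0.spinZ)
    {s q : ℝ} (hq : Real.exp (s - 1) ≤ q) :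
    0 ≤ (ω.expect Λ'
      (((β : ℝ) : ℂ) • ((fermionEmbed (PolySite.incl hΛ) A)ᴴ *
          ((hubbardTTPrimeFermionInteraction t t' U).localHamiltonian Λ' * fermionEmbed (PolySite.incl hΛ) A -
            fermionEmbed (PolySite.incl hΛ) A * (hubbardTTPrimeFermionInteraction t t' U).localHamiltonian Λ')) -
        ((s : ℝ) : ℂ) • ((fermionEmbed (PolySite.incl hΛ) A)ᴴ * fermionEmbed (PolySite.incl hΛ) A) +
        ((q : ℝ) : ℂ) • (fermionEmbed (PolySite.incl hΛ) A * (fermionEmbed (PolySite.incl hΛ) A)ᴴ))).re := by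
  have hA : fermionEmbed (PolySite.incl hΛ) A =
      fermionEmbed (PolySite.incl h8) (fermionEmbed (PolySite.incl (subset_thicken Λ 1)) A) := by
    rw [fermionEmbed_fermionEmbed, PolySite.incl_trans]
  rw [hubbardTTPrime_localHamiltonian_commutator_fermionEmbed_eq t t' U hΛ h8 A, hA,
    ← fermionEmbed_conjTranspose, ← fermionEmbed_mul, ← fermionEmbed_mul, ← fermionEmbed_mul,
    ← fermionEmbed_smul, ← fermionEmbed_smul, ← fermionEmbed_smul, ← fermionEmbed_sub, ← fermionEmbed_add,
    ω.compatible h8]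
  exact h.re_expect_eeb_nonneg_of_sectorGibbs t t' U β hLs hAN hAS hq

end InfVolFermionState

end Literature.MathematicalPhysics.QuantumLattice

end
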